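import Literature.NumberTheory.Automorphic.CDTTheorem722
import Literature.NumberTheory.EllipticCurves.FramedTateGaloisRep
import Literature.NumberTheory.EllipticCurves.FrobeniusTraceBaseChange
import Literature.NumberTheory.EllipticCurves.NeronOggShafarevichProofs
import Literature.NumberTheory.EllipticCurves.IsogenyFrobeniusTraceProofs
import HarnessLib

/-!
# Stub-ideation k1 (GEN 6, 2026-08-31) for `stub_liftFive` (crux stmt-ABC-11340, line `Sketch`)

Backs `STUB-IDEAS-stub_liftFive-1.md` (HOME FAMILY 1 — RECOGNISE & IMPORT), gen 6; namespace
`…StubIdeasLiftFive1g6`.  Elaboration sanity + glue: the gen-4/gen-5 companions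
(`STUB_IDEAS_stub_liftFive_1.lean`, `STUB_IDEAS_stub_liftFive_1g5.lean`) stay valid and are not
repeated.

GEN-6 CONTENT — the PORTS of the printed R = T engine onto the tree's predicates:

* the engine's OUTPUT in print is "`ρ_{E,p}` is modular" in the sense of Darmon–Diamond–Taylor,
  Def. 3.16 / Cor. 3.46 (`ρ ≅ ρ_g` for a WEIGHT-2 newform `g`), typed here over EXISTING carriers as
  `IsFramedModularTate W p` := `∃ M g ι, IsNewform1 g ∧ IsGaloisRepOfNewform1 g ι {r ∣ M p}
  (W.framedTateGaloisRep p)` (`FramedTateGaloisRep.lean`, `NewformGaloisRep.lean`);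
* `OutAdapter` : `IsFramedModularTate W p → W.IsModularGaloisRepTate p` (BCDT condition (4), the
  stub's conclusion) — PROVED below from the tree's transfer lemmas `T_p E ↔ V_p E ↔ framed`;
* the umbrella import (Diamond 1996 Thm 5.3 = Rubin CSS 1997 Thm B) typed with that WEAKEST
  faithful conclusion (`ModularityLifting_framed`, `ModularityLifting_tate`) instead of BCDT
  condition (2) `IsModular W` (gen 4's `Rubin1997_theoremB_at`), and the kernel-checked closers
  `framed ⇒ tate ⇒ stub`, `mod ⇒ tate`, `CDT_theorem_7_2_2 ⇒ tate 5`;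
* the engine's INPUT port is already a THEOREM of the tree
  (`BCDT.IsModular.isModular_of_isTorsionGaloisRep'`, weight 2 / level `N_E'` inside its proof) —
  cited, not restated.
-/

set_option autoImplicit false
set_option linter.dupNamespace false

noncomputable section

open scoped NumberField MatrixGroups Polynomial ModularForm
open NumberField IsDedekindDomain Field WeierstrassCurve Rat.HeightOneSpectrum
  IsDedekindDomain.HeightOneSpectrum Polynomial CongruenceSubgroup
  Literature.NumberTheory
  Literature.NumberTheory.GaloisRepresentations Literature.NumberTheory.Automorphic
  Literature.NumberTheory.Automorphic.BCDT Literature.NumberTheory.EllipticCurves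
  Literature.NumberTheory.EllipticCurves.ModularForms

namespace Summit.ABC.ABC.Cruxes.FreyModularity.StubIdeasLiftFive1g6

/-! ## The stub, verbatim -/

/-- `stub_liftFive` of `Lines/Sketch.lean`, verbatim. -/
def LiftFive : Prop :=
  ∀ (W : WeierstrassCurve ℚ) [W.IsElliptic] (ρ : ModPGaloisRep ℚ (ZMod 5) 2),
    W.IsTorsionGaloisRep 5 ρ → ρ.IsAbsIrreducibleOverSqrt 5 → ¬ 25 ∣ W.conductorNorm ℤ →
    ρ.IsModular → W.IsModularGaloisRepTate 5

/-! ## The engine's output port, typed on tree carriers -/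

/-- `p* = (-1)^{(p-1)/2} p` (Rubin CSS 1997, Thm. B: `ℚ(√p*)`). -/
def pStar (p : ℕ) : ℚ := (-1) ^ ((p - 1) / 2) * p

theorem pStar_five : pStar 5 = 5 := by norm_num [pStar]

/-- **"`ρ_{E,p}` is modular" in the sense of DDT Def. 3.16 / Cor. 3.46** (weight-2 newform `g`,
some level `M`, `ρ_{E,p} ≅ ρ_{g,λ}`), on the tree's framed `p`-adic representation
`W.framedTateGaloisRep p : Γ_ℚ →ₜ* GL₂(ℚ̄_p)` and the tree's attachment predicate
`IsGaloisRepOfNewform1` (unramified with the Hecke polynomial as Frobenius charpoly off `M p`). -/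
def IsFramedModularTate (W : WeierstrassCurve ℚ) [W.IsElliptic] (p : ℕ) [Fact p.Prime] : Prop :=
  ∃ (M : ℕ) (_ : NeZero M) (g : CuspForm (Gamma1 M) 2) (ι : coeffCharField g →+* PadicAlgCl p),
    IsNewform1 g ∧ IsGaloisRepOfNewform1 g ι {r | r ∣ M * p} (W.framedTateGaloisRep p)

/-- **Import candidate F⁎ (framed conclusion)**: Diamond 1996 Thm. 5.3 = Rubin (CSS 1997) Thm. B,
for an odd prime `p`: `E` semistable at `p` (`p² ∤ N_E`), `ρ̄_{E,p}|ℚ(√p*)` absolutely irreducible,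
`ρ̄_{E,p}` modular ⇒ `ρ_{E,p}` modular (weight 2). -/
def ModularityLifting_framed (p : ℕ) [Fact p.Prime] : Prop :=
  ∀ (W : WeierstrassCurve ℚ) [W.IsElliptic] (ρ : ModPGaloisRep ℚ (ZMod p) 2),
    W.IsTorsionGaloisRep p ρ → ρ.IsAbsIrreducibleOverSqrt (pStar p) →
    ¬ p ^ 2 ∣ W.conductorNorm ℤ → ρ.IsModular → IsFramedModularTate W p

/-- **Import candidate F⁎ (conclusion = BCDT condition (4))**. -/
def ModularityLifting_tate (p : ℕ) [Fact p.Prime] : Prop :=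
  ∀ (W : WeierstrassCurve ℚ) [W.IsElliptic] (ρ : ModPGaloisRep ℚ (ZMod p) 2),
    W.IsTorsionGaloisRep p ρ → ρ.IsAbsIrreducibleOverSqrt (pStar p) →
    ¬ p ^ 2 ∣ W.conductorNorm ℤ → ρ.IsModular → W.IsModularGaloisRepTate p

/-- Gen-4's typing (conclusion = BCDT condition (2), `IsModular W`), for comparison. -/
def ModularityLifting_mod (p : ℕ) [Fact p.Prime] : Prop :=
  ∀ (W : WeierstrassCurve ℚ) [W.IsElliptic] [NeZero (W.conductorNorm ℤ)]
    (ρ : ModPGaloisRep ℚ (ZMod p) 2),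
    W.IsTorsionGaloisRep p ρ → ρ.IsAbsIrreducibleOverSqrt (pStar p) →
    ¬ p ^ 2 ∣ W.conductorNorm ℤ → ρ.IsModular → IsModular W

/-- **OUT adapter** (helper H1): DDT-modular (framed, weight 2) ⇒ BCDT condition (4). -/
def OutAdapter (p : ℕ) [Fact p.Prime] : Prop :=
  ∀ (W : WeierstrassCurve ℚ) [W.IsElliptic], IsFramedModularTate W p → W.IsModularGaloisRepTate p

/-! ## H1a / H1b: the two transfer lemmas `framed ρ_{E,ℓ}` ↔ `T_ℓ E` -/

/-- **H1a.** If the framed `ρ_{E,ℓ}` is unramified at `v` then inertia at `v` acts trivially on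
`T_ℓ E` (`isUnramifiedAt_framedTateGaloisRep_iff` + `T_ℓ E ↪ V_ℓ E`,
`galoisRepTate_eq_one_of_rationalGaloisRepTate_eq_one`). [folklore] -/
theorem H1a_galoisRepTate_eq_one_of_isUnramifiedAt (W : WeierstrassCurve ℚ) [W.IsElliptic]
    (ℓ : ℕ) [Fact ℓ.Prime] {v : HeightOneSpectrum (𝓞 ℚ)}
    (h : (W.framedTateGaloisRep ℓ).IsUnramifiedAt v) :
    ∀ 𝔓 ∈ v.primesAbove, ∀ σ ∈ 𝔓.inertia (absoluteGaloisGroup ℚ), W.galoisRepTate ℓ σ = 1 := by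
  intro 𝔓 h𝔓 σ hσ
  have h1 := ((W.isUnramifiedAt_framedTateGaloisRep_iff ℓ
    (W.continuous_rationalGaloisRepTate_holds ℓ) v).mp h) 𝔓 h𝔓 σ hσ
  exact W.galoisRepTate_eq_one_of_rationalGaloisRepTate_eq_one ℓ h1

/-- **H1b.** The characteristic polynomial of the framed `ρ_{E,ℓ}(σ)` is `charpoly(σ | T_ℓ E)`
pushed along `ℤ_ℓ → ℚ_ℓ → ℚ̄_ℓ` (`charpoly_framedTateGaloisRep_apply`, `V_ℓ = ℚ_ℓ ⊗ T_ℓ`,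
`LinearMap.charpoly_baseChange`). [folklore] -/
theorem H1b_charpoly_framedTateGaloisRep_eq_map (W : WeierstrassCurve ℚ) [W.IsElliptic]
    (ℓ : ℕ) [Fact ℓ.Prime] (σ : absoluteGaloisGroup ℚ) :
    haveI := module_free_tateModule_holds W ℓ
    haveI := module_finite_tateModule_holds W ℓ
    FramedRep.charpoly (W.framedTateGaloisRep ℓ) σ =
      ((W.galoisRepTate ℓ σ).charpoly.map (PadicInt.Coe.ringHom (p := ℓ))).map
        (algebraMap ℚ_[ℓ] (PadicAlgCl ℓ)) := by
  haveI := module_free_tateModule_holds W ℓ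
  haveI := module_finite_tateModule_holds W ℓ
  rw [W.charpoly_framedTateGaloisRep_apply ℓ σ]
  congr 1
  have hc : (algebraMap ℤ_[ℓ] ℚ_[ℓ] : ℤ_[ℓ] →+* ℚ_[ℓ]) = PadicInt.Coe.ringHom := RingHom.ext fun _ => rfl
  rw [← hc]
  exact LinearMap.charpoly_baseChange (W.galoisRepTate ℓ σ) ℚ_[ℓ]

/-- **H1 (OUT adapter), proved from H1a/H1b** and the tree's `map_charpoly_galoisRepTate_eq`
(`X² - tr X + det = charpoly` on the free rank-2 `T_ℓ E`). [folklore] -/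
theorem outAdapter_holds (p : ℕ) [Fact p.Prime] : OutAdapter p := by
  intro W _ h
  obtain ⟨M, hM, g, ι, hg, hatt⟩ := h
  haveI := module_free_tateModule_holds W p
  haveI := module_finite_tateModule_holds W p
  refine ⟨M, hM, 2, g, PadicAlgCl p, inferInstance, inferInstance, ι, by norm_num, hg, ?_⟩
  intro v hv 𝔓 h𝔓
  obtain ⟨hur, hchar⟩ := hatt v hv
  refine ⟨H1a_galoisRepTate_eq_one_of_isUnramifiedAt W p hur 𝔓 h𝔓, fun σ hσ => ?_⟩
  have hc := hchar 𝔓 h𝔓 σ hσ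
  rw [H1b_charpoly_framedTateGaloisRep_eq_map W p σ] at hc
  rw [← Polynomial.map_map, ← W.map_charpoly_galoisRepTate_eq p (PadicInt.Coe.ringHom (p := p)) σ]
  exact hc

/-! ## The engine's input port: weight-2 residual modularity -/

/-- **DDT Def. 3.12 ("`ρ̄` is modular": `ρ̄ ≅ ρ̄_f` for a newform `f` of WEIGHT 2)** — the
`w = 2` slice of the tree's any-weight `ModPGaloisRep.IsModular` (BCDT's notion). -/
def IsModularWeightTwo {k : Type} [Field k] [TopologicalSpace k] [DiscreteTopology k]
    (ρ : ModPGaloisRep ℚ k 2) : Prop :=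
  ∃ (N : ℕ) (_ : NeZero N) (f : CuspForm (Gamma1 N) 2) (K : Type) (_ : Field K)
    (_ : TopologicalSpace K) (_ : DiscreteTopology K) (j : k →+* K)
    (ι : coeffCharIntegers f →+* K),
    IsNewform1 f ∧
      IsGaloisRepOfNewform1Int f ι {q | q ∣ N * ringChar k}
        (FramedRep.baseChange j continuous_of_discreteTopology ρ)

/-- Weight-2 modular ⇒ BCDT-modular (forgetful). [folklore] -/
theorem isModular_of_isModularWeightTwo {k : Type} [Field k] [TopologicalSpace k]
    [DiscreteTopology k] {ρ : ModPGaloisRep ℚ k 2} (h : IsModularWeightTwo ρ) : ρ.IsModular := by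
  obtain ⟨N, hN, f, K, hK, hT, hD, j, ι, hf, hatt⟩ := h
  exact ⟨N, hN, 2, f, K, hK, hT, hD, j, ι, by norm_num, hf, hatt⟩

/-- **IN1 (named-fact candidate, NOT a one-cycle lemma)**: for absolutely irreducible `ρ̄`,
BCDT-modular (any weight `w ≥ 1`) ⇒ weight-2 modular (Ash–Stevens 1986 Thm. 3.5 / Serre's
weight recipe + Deligne–Serre for `w = 1`; the reading documented at `CDT_theorem_7_2_2`). -/
def IN1 (p : ℕ) [Fact p.Prime] : Prop :=
  ∀ ρ : ModPGaloisRep ℚ (ZMod p) 2, FramedRep.IsAbsolutelyIrreducible ρ → ρ.IsModular →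
    IsModularWeightTwo ρ

/-- **IN2 (helper, M): instance-level weight-2 modularity.** If `E'/ℚ` is modular (BCDT (2)) then
every framed model of `E'[ℓ]` is weight-2 modular, attached to the `Γ₁(N_{E'})`-lift of the
newform of `E'`.  Proof = the tree's `BCDT.IsModular.isModular_of_isTorsionGaloisRep` VERBATIM
(its witness already has `w := 2`, `N := N_{E'}`), inputs discharged as in
`isModular_of_isTorsionGaloisRep''` (`CDTTheorem712`). [folklore] -/
theorem IN2_isModularWeightTwo_of_isTorsionGaloisRep {W : WeierstrassCurve ℚ} [W.IsElliptic]
    [NeZero (W.conductorNorm ℤ)] (hE : IsModular W) {ℓ : ℕ} [Fact ℓ.Prime]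
    {ρ : ModPGaloisRep ℚ (ZMod ℓ) 2} (hρ : W.IsTorsionGaloisRep ℓ ρ) : IsModularWeightTwo ρ := by
  sorry

/-- **The stub re-cut on the weight-2 port** (`LiftFiveW2`): same as `stub_liftFive` but with
DDT's weight-2 residual modularity as hypothesis — WEAKER than the stub, and still what the
assembly feeds it on the Frey instance (the residual modularity there comes from the modular
curve `E'` of `stub_switch`, through IN2). -/
def LiftFiveW2 : Prop :=
  ∀ (W : WeierstrassCurve ℚ) [W.IsElliptic] (ρ : ModPGaloisRep ℚ (ZMod 5) 2),
    W.IsTorsionGaloisRep 5 ρ → ρ.IsAbsIrreducibleOverSqrt 5 → ¬ 25 ∣ W.conductorNorm ℤ →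
    IsModularWeightTwo ρ → W.IsModularGaloisRepTate 5

/-- The stub implies its weight-2 re-cut. [folklore] -/
theorem liftFiveW2_of_liftFive (h : LiftFive) : LiftFiveW2 :=
  fun W _ ρ hρ hirr h25 hmod => h W ρ hρ hirr h25 (isModular_of_isModularWeightTwo hmod)

/-- **Import candidate F_DDT (the engine as printed: DDT Cor. 3.46 ∩ {semistable at `p` only},
= Diamond 1996 Thm. 5.3 with DDT's Def. 3.12 input and Def. 3.16 output).** -/
def Engine_DDT (p : ℕ) [Fact p.Prime] : Prop :=
  ∀ (W : WeierstrassCurve ℚ) [W.IsElliptic] (ρ : ModPGaloisRep ℚ (ZMod p) 2),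
    W.IsTorsionGaloisRep p ρ → ρ.IsAbsIrreducibleOverSqrt (pStar p) →
    ¬ p ^ 2 ∣ W.conductorNorm ℤ → IsModularWeightTwo ρ → IsFramedModularTate W p

/-- `Engine_DDT 5` closes the weight-2 re-cut outright (OUT adapter proved). -/
theorem liftFiveW2_of_engine (h : Engine_DDT 5) : LiftFiveW2 := by
  intro W _ ρ hρ hirr h25 hmod
  exact outAdapter_holds 5 W
    (h W ρ hρ (by rw [pStar_five]; exact hirr) (by simpa using h25) hmod)

/-- `Engine_DDT 5` + IN1 (Ash–Stevens reading) closes the stub as typed. -/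
theorem liftFive_of_engine_of_IN1 (h : Engine_DDT 5) (hin : IN1 5) : LiftFive := by
  intro W _ ρ hρ hirr h25 hmod
  exact liftFiveW2_of_engine h W ρ hρ hirr h25 (hin ρ hirr.isAbsolutelyIrreducible hmod)

/-- On the instance shape the assembly uses (`ρ̄ = E'[5]`, `E'` modular): the re-cut stub is fed
by IN2, no IN1 needed. -/
theorem isModularGaloisRepTate_five_of_engine_of_modular_curve (h : Engine_DDT 5)
    (W : WeierstrassCurve ℚ) [W.IsElliptic] (ρ : ModPGaloisRep ℚ (ZMod 5) 2)
    (hρ : W.IsTorsionGaloisRep 5 ρ) (hirr : ρ.IsAbsIrreducibleOverSqrt 5)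
    (h25 : ¬ 25 ∣ W.conductorNorm ℤ) (W' : WeierstrassCurve ℚ) [W'.IsElliptic]
    [NeZero (W'.conductorNorm ℤ)] (hE' : IsModular W') (hρ' : W'.IsTorsionGaloisRep 5 ρ) :
    W.IsModularGaloisRepTate 5 :=
  liftFiveW2_of_engine h W ρ hρ hirr h25 (IN2_isModularWeightTwo_of_isTorsionGaloisRep hE' hρ')

/-! ## Closers (kernel-checked glue) -/

/-- framed fact + OUT adapter ⇒ (4)-fact. -/
theorem modularityLifting_tate_of_framed (p : ℕ) [Fact p.Prime] (h : ModularityLifting_framed p)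
    (hout : OutAdapter p) : ModularityLifting_tate p :=
  fun W _ ρ hρ hirr hp2 hmod => hout W (h W ρ hρ hirr hp2 hmod)

/-- (2)-fact (gen 4's typing) ⇒ (4)-fact, by the tree's PROVED (2) ⇒ (4)
`IsModular.isModularGaloisRepTate` and `conductorNorm_pos_holds`. -/
theorem modularityLifting_tate_of_mod (p : ℕ) [Fact p.Prime] (h : ModularityLifting_mod p) :
    ModularityLifting_tate p := by
  intro W _ ρ hρ hirr hp2 hmod
  haveI : NeZero (W.conductorNorm ℤ) := ⟨(conductorNorm_pos_holds W).ne'⟩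
  exact (h W ρ hρ hirr hp2 hmod).isModularGaloisRepTate p

/-- The (4)-fact at `p = 5` closes the stub. -/
theorem liftFive_of_tate (h : ModularityLifting_tate 5) : LiftFive := by
  intro W _ ρ hρ hirr h25 hmod
  exact h W ρ hρ (by rw [pStar_five]; exact hirr) (by simpa using h25) hmod

/-- The framed fact at `p = 5` closes the stub (OUT adapter proved). -/
theorem liftFive_of_framed (h : ModularityLifting_framed 5) : LiftFive :=
  liftFive_of_tate (modularityLifting_tate_of_framed 5 h (outAdapter_holds 5))

/-- Gen 4's `Rubin1997_theoremB_at 5`-shaped fact closes the stub. -/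
theorem liftFive_of_mod (h : ModularityLifting_mod 5) : LiftFive :=
  liftFive_of_tate (modularityLifting_tate_of_mod 5 h)

/-- Calibration: the catalogued `CDT_theorem_7_2_2` gives the (4)-fact at `5` (it even drops the
`25 ∤ N` hypothesis), via the tree's `lift_of_CDT_theorem_7_2_2`. -/
theorem modularityLifting_tate_five_of_CDT (h : CDT_theorem_7_2_2) : ModularityLifting_tate 5 :=
  fun W _ ρ hρ hirr _ hmod =>
    lift_of_CDT_theorem_7_2_2 h W ρ hρ (by rw [pStar_five] at hirr; exact hirr) hmod

/-- Conversely the stub IS the (4)-fact at `5` (definitional repackaging; `pStar 5 = 5`). -/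
theorem tate_five_of_liftFive (h : LiftFive) : ModularityLifting_tate 5 := by
  intro W _ ρ hρ hirr h25 hmod
  exact h W ρ hρ (by rw [pStar_five] at hirr; exact hirr) (by simpa using h25) hmod

end Summit.ABC.ABC.Cruxes.FreyModularity.StubIdeasLiftFive1g6

end
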